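import Literature.MathematicalPhysics.QuantumFieldTheory.Balaban1983to89.T3CentreSymmetry
import Literature.MathematicalPhysics.QuantumFieldTheory.Balaban1983to89.T3CovarianceRP
import Literature.MathematicalPhysics.QuantumFieldTheory.Balaban1983to89.T4ApexTwoLevel
import Literature.MathematicalPhysics.QuantumFieldTheory.Balaban1983to89.T4GenFunBounds
import HarnessLib

/-!
# Route `ColdStartUniversality`, crux K_A1|Γ `NeutralColdStartMixing` (stmt-QuantumFields-27363), line «valley_averaging»
# (planner ym-idea-5 g7, skeleton v2): support stub C1 `stub_valleyCoordinateMeasurable`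

Helper file (seat `ym-line-csu-p1`, route-affine; the critic's price C1 of VERDICT #81, size S, «to be landed FIRST»).
The valley coordinate `θ_K : V ↦ (|USite|⁻¹ Σ_x avgObs K (polyakov μ x) V)_μ` is measurable (so the `condExp` in
`AdiabaticValleyTracking` is the genuine Gibbs conditional expectation), and every loop-string product
`V ↦ ∏_{C ∈ os} avgObs K C V` is integrable for Bałaban's step-`K` Gibbs measure (bounded by `1`, measurable, probability
measure for `β_K = (γ ε_K)⁻¹ ≥ 0`).  Proof = the planner's sketch: `measurable_pi_lambda` + `Finset.measurable_sum` +
`T3Family.measurable_avgObs` / `avgMeasurable_of_measurableE … measurableE_expMeanLogSU`; `abs_avgObs_le_one`,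
`T4GenFunBounds.isProbabilityMeasure_gibbsMeasure`.  Statement = the registered signature verbatim.  No definition, no
sorry.  RECORD-rung R3 plumbing; nothing here bears on K_A1|Γ itself or the mass gap. -/

set_option autoImplicit false

noncomputable section

namespace Summit.QuantumFields.YangMills.Theorems.ColdStartUniversality

open MeasureTheory
open Literature.MathematicalPhysics.QuantumFieldTheory
open Literature.MathematicalPhysics.QuantumLattice (fundamentalRep continuous_fundamentalRep)
open Literature.MathematicalPhysics.QuantumFieldTheory.Balaban1983to89

/-- **Stub C1 `stub_valleyCoordinateMeasurable` of line «valley_averaging» (stmt-QuantumFields-27363)**: the block-averaged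
Polyakov valley coordinate is measurable and loop-string products are Gibbs-integrable. [folklore] -/
theorem stub_valleyCoordinateMeasurable : ∀ (F : Literature.MathematicalPhysics.QuantumFieldTheory.Balaban1983to89.T3ContinuumYM3Torus.T3Family) (γ : ℝ), 0 < γ → ∀ (K : ℕ), Measurable (fun (V : Literature.MathematicalPhysics.QuantumFieldTheory.Balaban1983to89.GaugeField (F.P K) 0 (Matrix.specialUnitaryGroup (Fin 2) ℂ)) (μ : Fin 3) => (Fintype.card F.USite : ℝ)⁻¹ * ∑ x : F.USite, F.avgObs (Literature.MathematicalPhysics.QuantumFieldTheory.Balaban1983to89.ExpMeanLog.expMeanLogSU : Literature.MathematicalPhysics.QuantumFieldTheory.Balaban1983to89.LoopAverage (Matrix.specialUnitaryGroup (Fin 2) ℂ)) K (Literature.MathematicalPhysics.QuantumFieldTheory.Balaban1983to89.T3ContinuumYM3Torus.ULoop3.polyakov μ x) V) ∧ ∀ (os : List (Literature.MathematicalPhysics.QuantumFieldTheory.Balaban1983to89.T3ContinuumYM3Torus.ULoop3 F)), MeasureTheory.Integrable (fun V => (os.map fun C => F.avgObs (Literature.MathematicalPhysics.QuantumFieldTheory.Balaban1983to89.ExpMeanLog.expMeanLogSU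 : Literature.MathematicalPhysics.QuantumFieldTheory.Balaban1983to89.LoopAverage (Matrix.specialUnitaryGroup (Fin 2) ℂ)) K C V).prod) (Literature.MathematicalPhysics.QuantumFieldTheory.Balaban1983to89.T4GenFunBounds.gibbsMeasure (G := Matrix.specialUnitaryGroup (Fin 2) ℂ) (F.P K) ((F.scheme (Literature.MathematicalPhysics.QuantumFieldTheory.Balaban1983to89.ExpMeanLog.expMeanLogSU : Literature.MathematicalPhysics.QuantumFieldTheory.Balaban1983to89.LoopAverage (Matrix.specialUnitaryGroup (Fin 2) ℂ)) γ).β K)) := by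
  intro F γ hγ K
  have hm : ∀ (K' : ℕ) (C : T3ContinuumYM3Torus.ULoop3 F),
      Measurable (F.avgObs (ExpMeanLog.expMeanLogSU : LoopAverage (Matrix.specialUnitaryGroup (Fin 2) ℂ)) K' C) :=
    fun K' C => F.measurable_avgObs (F.avgMeasurable_of_measurableE _ T4ApexTwoLevel.measurableE_expMeanLogSU) K' C
  refine ⟨?_, fun os => ?_⟩
  · refine measurable_pi_lambda _ fun μ => ?_
    exact (Finset.measurable_sum _ fun x _ => hm K _).const_mul _
  · have hβ : 0 ≤ (F.scheme (ExpMeanLog.expMeanLogSU : LoopAverage (Matrix.specialUnitaryGroup (Fin 2) ℂ)) γ).β K :=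
      F.scheme_β_nonneg _ hγ.le K
    haveI := T4GenFunBounds.isProbabilityMeasure_gibbsMeasure (G := Matrix.specialUnitaryGroup (Fin 2) ℂ) (F.P K) hβ
    have hmeas : Measurable (fun V : GaugeField (F.P K) 0 (Matrix.specialUnitaryGroup (Fin 2) ℂ) =>
        (os.map fun C => F.avgObs (ExpMeanLog.expMeanLogSU :
          LoopAverage (Matrix.specialUnitaryGroup (Fin 2) ℂ)) K C V).prod) :=
      T4GenFunBounds.measurable_prodObs
        (F.scheme (ExpMeanLog.expMeanLogSU : LoopAverage (Matrix.specialUnitaryGroup (Fin 2) ℂ)) γ) hm K os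
    have hbd : ∀ V : GaugeField (F.P K) 0 (Matrix.specialUnitaryGroup (Fin 2) ℂ),
        |(os.map fun C => F.avgObs (ExpMeanLog.expMeanLogSU :
          LoopAverage (Matrix.specialUnitaryGroup (Fin 2) ℂ)) K C V).prod| ≤ 1 := fun V =>
      T4GenFunBounds.abs_prodObs_le_one
        (F.scheme (ExpMeanLog.expMeanLogSU : LoopAverage (Matrix.specialUnitaryGroup (Fin 2) ℂ)) γ)
        (fun K' C U => F.abs_avgObs_le_one _ K' C U) K os V
    refine Integrable.mono' (integrable_const (1 : ℝ)) hmeas.aestronglyMeasurable (ae_of_all _ fun V => ?_)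
    rw [Real.norm_eq_abs]
    exact hbd V

end Summit.QuantumFields.YangMills.Theorems.ColdStartUniversality

end
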